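/-
Copyright (c) 2026 the pub-hodgecm-mathlib formalisation cell (harness21).  Prover seat hodgecm-mathlib-B-p14 (g30), (F11) LAYER B′ FILE 3 (ii-a): the fixed-point
criterion of Prop. 16 in coordinates (DESIGN v3 §FILE 3; architect A-p06 (g26); FILES 1∕2a A-p13 (g30), (2b) B-p10 (g24)), 2026-09-01.
-/
import Literature.NumberTheory.Automorphic.UnitaryThreeAnisotropicStabilizerCosetCriterion   -- ★ p841659 (A-p13): coset criterion `conj_mem_unitaryInt_iff_of_mul_eq`
import Literature.NumberTheory.Automorphic.UnitaryThreeAnisotropicConjugationEntries         -- ★ p841676 (this seat): entries of `h⁻¹th` in the model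
import HarnessLib

/-!
# Flicker's Proposition 16, step (ii-a): `t • (h H′_m) = h H′_m` in coordinates — `(h d_m)⁻¹ t (h d_m) ∈ K₀ ↔` two valuation inequalities in `(A, q, s)` of `h`
# and `(A_t, q_t, ρ_t, s_t)` of `t` (Flicker 1998, Prop. 16 p. 96)

Topic `NumberTheory/Automorphic`; namespace `Literature.NumberTheory.Automorphic.UnitaryGroup`.  THEOREMS ONLY.  Cell `pub/hodgecm-mathlib`, crux H413, line «N7nsCount»,
value stub `stub_irredGValueNeg` (κ = −1), LAYER B′ = Prop. 16's count of the `t`-fixed cosets `hH′_m ∈ Stab(w₀) ⧸ H′_m` (★ (F2′) `smul_mk_eq_iff_flickerDiag`: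
`t • hH′_m = hH′_m ↔ (h d_m)⁻¹ t (h d_m) ∈ K₀`).  FRAME = ★ (C′)∕Bounds∕A-p13 FILE 1: `t, h ∈ Stab(w₀)` in `(b, q, r, s)` coordinates, `A = 1 + 4ϖb`, `ρ = 4ϖr`,
`Δ_h = A s − ρ q`.
* `shape_mulVec_anisoVec` — a matrix of the (C′) shape fixes `w₀` (converse of ★ `exists_coe_eq_of_mulVec_anisoVec_eq`);
* **`fixedPoint_mem_unitaryInt_iff`**: `(h d_m)⁻¹ t (h d_m) ∈ K₀ ↔ |(A_t − s_t)·s·q + q_t·s² − ρ_t·q²| ≤ |ϖ^m| ∧ |s·(A_t A + q_t ρ) − q·(ρ_t A + s_t ρ) − Δ_h| ≤ |ϖ^{2m+1}|`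
  — A-p13's coset criterion at `k := h⁻¹th`, `h′ := th`, with the coordinates of `th` eliminated through ★ `stabilizerModel_mul` (`M_{th} = M_t M_h`).  The two
  expressions are `Δ_h ×` the entries ★ `conj_model_entry01`∕`conj_model_entry00 − 1`; their valuations in the three regimes are FILE 3 (ii-b)∕(iii).
HONEST LABEL: HC_CM is proved only modulo the printed citations until rung 0 closes; structure theory feeding ONE value stub of #103-ns.

## References
* [Flicker1998UnitaryFL] Y. Z. Flicker, *Elementary proof of the fundamental lemma for a unitary group*, Canad. J. Math. 50 (1998), Prop. 16 p. 96.
-/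

set_option autoImplicit false

noncomputable section

open scoped MatrixGroups WithZero
open Matrix

namespace Literature.NumberTheory.Automorphic

namespace UnitaryGroup

open Literature.NumberTheory.Automorphic.HermitianLattice

variable {K : Type*} [Field K] [Valued K ℤᵐ⁰] {ϖ : K}
  (σ : K →+* K) {J : Matrix (Fin 3) (Fin 3) K} (hJ : J = (StdForm.antidiagonal 3).over K)

omit [Valued K ℤᵐ⁰] in
/-- A matrix of the (C′) shape FIXES `w₀ = ![1, 0, −2ϖ]` (converse of ★ `exists_coe_eq_of_mulVec_anisoVec_eq`). [cite: Flicker1998UnitaryFL, Prop. 4 p. 82] -/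
theorem shape_mulVec_anisoVec (ϖ b q r s : K) :
    (!![1 + 2 * ϖ * b, q, b; 2 * ϖ * r, s, r; 4 * ϖ ^ 2 * b, 2 * ϖ * q, 1 + 2 * ϖ * b] : Matrix (Fin 3) (Fin 3) K) *ᵥ ![1, 0, -(2 * ϖ)] =
      ![1, 0, -(2 * ϖ)] := by
  ext i
  fin_cases i <;> simp [Matrix.mulVec, dotProduct, Fin.sum_univ_three] <;> ring

include hJ in
/-- **PROP. 16's FIXED-POINT CRITERION IN COORDINATES.**  For `t, h ∈ Stab(w₀)` with (C′) coordinates `(b_t,q_t,r_t,s_t)`, `(b,q,r,s)` and Flicker's `d_m`: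
`(h d_m)⁻¹ t (h d_m) ∈ K₀ ↔ |(A_t − s_t)·s·q + q_t·s² − ρ_t·q²| ≤ |ϖ^m| ∧ |s·(A_t A + q_t ρ) − q·(ρ_t A + s_t ρ) − (A s − ρ q)| ≤ |ϖ^{2m+1}|`
(`A = 1+4ϖb`, `ρ = 4ϖr`, etc.) — i.e. `t` fixes the coset `h H′_m` iff these two congruences hold. [cite: Flicker1998UnitaryFL, Prop. 16 p. 96] -/
theorem fixedPoint_mem_unitaryInt_iff (hd : LocalConjDatum σ ϖ) (m : ℕ) {d t h : ↥(unitaryGroupOfForm σ J)}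
    (hdm : ((d : GL (Fin 3) K) : Matrix (Fin 3) (Fin 3) K) = !![ϖ ^ m, 0, 0; 0, 1, 0; 0, 0, (ϖ ^ m)⁻¹]) {bt qt rt st b q r s : K}
    (ht : ((t : GL (Fin 3) K) : Matrix (Fin 3) (Fin 3) K) =
      !![1 + 2 * ϖ * bt, qt, bt; 2 * ϖ * rt, st, rt; 4 * ϖ ^ 2 * bt, 2 * ϖ * qt, 1 + 2 * ϖ * bt])
    (hh : ((h : GL (Fin 3) K) : Matrix (Fin 3) (Fin 3) K) = !![1 + 2 * ϖ * b, q, b; 2 * ϖ * r, s, r; 4 * ϖ ^ 2 * b, 2 * ϖ * q, 1 + 2 * ϖ * b]) :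
    (h * d)⁻¹ * t * (h * d) ∈ unitaryInt σ J ↔
      Valued.v (((1 + 4 * ϖ * bt) - st) * s * q + qt * s ^ 2 - 4 * ϖ * rt * q ^ 2) ≤ Valued.v (ϖ ^ m) ∧
        Valued.v (s * ((1 + 4 * ϖ * bt) * (1 + 4 * ϖ * b) + qt * (4 * ϖ * r)) - q * (4 * ϖ * rt * (1 + 4 * ϖ * b) + st * (4 * ϖ * r)) -
          ((1 + 4 * ϖ * b) * s - 4 * ϖ * q * r)) ≤ Valued.v (ϖ ^ (2 * m + 1)) := by
  -- coordinates of `k := h⁻¹ t h` and `h′ := t h` (both fix `w₀`)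
  have hw₀t : ((t : GL (Fin 3) K) : Matrix (Fin 3) (Fin 3) K) *ᵥ ![1, 0, -(2 * ϖ)] = ![1, 0, -(2 * ϖ)] := by rw [ht, shape_mulVec_anisoVec]
  have hw₀h : ((h : GL (Fin 3) K) : Matrix (Fin 3) (Fin 3) K) *ᵥ ![1, 0, -(2 * ϖ)] = ![1, 0, -(2 * ϖ)] := by rw [hh, shape_mulVec_anisoVec]
  have hmat : ∀ a c : ↥(unitaryGroupOfForm σ J), (((a * c : ↥(unitaryGroupOfForm σ J)) : GL (Fin 3) K) : Matrix (Fin 3) (Fin 3) K) =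
      ((a : GL (Fin 3) K) : Matrix (Fin 3) (Fin 3) K) * ((c : GL (Fin 3) K) : Matrix (Fin 3) (Fin 3) K) := fun a c => by
    rw [Subgroup.coe_mul, Units.val_mul]
  have hw₀hinv : (((h⁻¹ : ↥(unitaryGroupOfForm σ J)) : GL (Fin 3) K) : Matrix (Fin 3) (Fin 3) K) *ᵥ ![1, 0, -(2 * ϖ)] = ![1, 0, -(2 * ϖ)] := by
    have h1 : (((h⁻¹ * h : ↥(unitaryGroupOfForm σ J)) : GL (Fin 3) K) : Matrix (Fin 3) (Fin 3) K) = 1 := by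
      rw [inv_mul_cancel, Subgroup.coe_one, Units.val_one]
    have := congrArg (fun M : Matrix (Fin 3) (Fin 3) K => M *ᵥ (![1, 0, -(2 * ϖ)] : Fin 3 → K)) h1
    simp only [hmat, ← Matrix.mulVec_mulVec, hw₀h, Matrix.one_mulVec] at this
    exact this
  have hw₀th : (((t * h : ↥(unitaryGroupOfForm σ J)) : GL (Fin 3) K) : Matrix (Fin 3) (Fin 3) K) *ᵥ ![1, 0, -(2 * ϖ)] = ![1, 0, -(2 * ϖ)] := by
    rw [hmat, ← Matrix.mulVec_mulVec, hw₀h, hw₀t]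
  have hw₀k : (((h⁻¹ * t * h : ↥(unitaryGroupOfForm σ J)) : GL (Fin 3) K) : Matrix (Fin 3) (Fin 3) K) *ᵥ ![1, 0, -(2 * ϖ)] = ![1, 0, -(2 * ϖ)] := by
    rw [hmat, hmat, ← Matrix.mulVec_mulVec, ← Matrix.mulVec_mulVec, hw₀h, hw₀t, hw₀hinv]
  obtain ⟨b', q', r', s', hh'⟩ := exists_coe_eq_of_mulVec_anisoVec_eq σ hJ hd hw₀th
  obtain ⟨bk, qk, rk, sk, hk⟩ := exists_coe_eq_of_mulVec_anisoVec_eq σ hJ hd hw₀k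
  -- A-p13's coset criterion at `(h, k, h′)`
  have hhk : h * (h⁻¹ * t * h) = t * h := by group
  have hconj : (h * d)⁻¹ * t * (h * d) = d⁻¹ * (h⁻¹ * t * h) * d := by group
  rw [hconj, conj_mem_unitaryInt_iff_of_mul_eq σ hJ hd m hdm hh hk hh' hhk]
  -- eliminate the coordinates of `t h` through the model product `M_{th} = M_t M_h`
  have hM := stabilizerModel_mul σ (J := J) ht hh hh'
  have e00 := congrFun (congrFun hM 0) 0
  have e01 := congrFun (congrFun hM 0) 1
  have e10 := congrFun (congrFun hM 1) 0
  have e11 := congrFun (congrFun hM 1) 1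
  simp [Matrix.mul_apply, Fin.sum_univ_two] at e00 e01 e10 e11
  have h1 : s * q' - q * s' = ((1 + 4 * ϖ * bt) - st) * s * q + qt * s ^ 2 - 4 * ϖ * rt * q ^ 2 := by
    rw [e01, e11]; ring
  have h2 : s * (1 + 4 * ϖ * b') - 4 * ϖ * q * r' - ((1 + 4 * ϖ * b) * s - 4 * ϖ * q * r) =
      s * ((1 + 4 * ϖ * bt) * (1 + 4 * ϖ * b) + qt * (4 * ϖ * r)) - q * (4 * ϖ * rt * (1 + 4 * ϖ * b) + st * (4 * ϖ * r)) -
        ((1 + 4 * ϖ * b) * s - 4 * ϖ * q * r) := by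
    have e10' : 4 * ϖ * r' = 4 * ϖ * rt * (1 + 4 * ϖ * b) + st * (4 * ϖ * r) := e10
    rw [e00]
    linear_combination (-q) * e10'
  rw [h1, h2]

end UnitaryGroup

end Literature.NumberTheory.Automorphic

end
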